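import Mathlib
import Literature.NumberTheory.LFunctions.Zhang2022.Section7Eq714Mellin
import HarnessLib

/-!
# Zhang (2022) §7, proof of (7.15): the Mellin step for `𝔰*(R,r,h,d;θ)` (DAG node `Z22:§7.u038`),
# as an exact identity and with the bound the printed chain actually uses (factor `hr` restored)

Topic `Literature/NumberTheory/LFunctions/Zhang2022` (Landau–Siegel audit tree; verdict-neutral).
Y. Zhang, *Discrete mean estimates and the Landau–Siegel zero*, arXiv:2211.02515v1 (2022)
[Zhang2022LandauSiegel] — **an unrefereed manuscript under adjudication; nothing here asserts or
denies its Theorems 1–2.** Campaign D-0069, discharge lane (seat sz-d26, L2 LEDGER #9 R25). The node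
[Z22 p.38, tex L2043–2046], typed statement-exact by L2-t4 as `Section7cStatements.Step7u038`:

> By the Mellin transform and Lemma 5.4 (i),
> `𝔰*(R,r,h,d;θ) ≪ 𝓛^c ∫_{−∞}^{∞} |Σ_{l∈𝔌(Rh),(l,h)=1} (κ∗a₁)(dl)θ(l)l^{−1−it}| |Σ_{p≃P} θ̄(p)p^{1+it+β₃}| dt/(1+t²)`.

The Mellin transform (tree `Skeleton.DeltaW_eq_mellinInv`: `Δ(x) = (1/2π)∫x^{−(1+it)}δ(1+it)dt`, at
`x = l/(phr)`, where `x^{−(1+it)} = (hr)^{1+it}·l^{−(1+it)}·p^{1+it}`) gives the IDENTITY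
`𝔰* = (1/2π)∫ δ(1+it)(hr)^{1+it}[Σ_l(κ∗a₁)(dl)θ(l)l^{−1−it}][Σ_pθ̄(p)p^{1+it+β₃}]dt`
(`frakSstar_eq_integral`), hence `|𝔰*| ≤ hr·(1/2π)∫|δ(1+it)|·|Σ_l…|·|Σ_p…|dt` (`norm_frakSstar_le`)
and, by Lemma 5.4 (i) on `σ = 1` (tree `Skeleton.norm_deltaW_line_le`, `|δ(1+it)| ≤ K𝓛⁵¹⁹⁰/(1+t²)`),
the typed node's bound WITH THE FACTOR `hr` restored (`step7u038R_holds`, `k = 5190`). The printed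
display omits `hr` (typed faithfully so); it is not derivable in that form, but the printed end of the
chain two displays later, `R^{−3/2}Σ_rΣ*_θ|𝔰*| ≪ τ₅(d)h𝓛^c(R^{1/2}P^{3/2} + R^{−1/2}P²)` (tex L2055),
is exactly what the `hr ≤ 2hR` form yields after the large sieve and Cauchy — a local slip of one
display, immaterial to (7.15) (plan/GAP-LEDGER.md row G-d26-1). The single-`l` companion (7.14)
carries `hr/l` correctly and is the tree's `Skeleton.eq714_holds` (sz-d51).

WHAT THIS IS NOT: a proof of the display AS PRINTED, of u039/u040, of (7.15), or any claim about
Theorems 1–2 / Landau–Siegel zeros.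

## References

* Y. Zhang, arXiv:2211.02515v1 (2022), §7 p.38 (proof of (7.15)), tex L2030–2058; §5 (5.14),
  Lemma 5.4 (i). [cite: Zhang2022LandauSiegel, §7 p.38]
-/

noncomputable section

open Complex Real Set MeasureTheory Filter Topology
open Literature.NumberTheory.LFunctions.Zhang2022.Section7cStatements

namespace Literature.NumberTheory.LFunctions.Zhang2022.Section7cMellin

open Skeleton
open scoped Classical
/-! ### §1. Plumbing: the line `s = 1 + it` -/
/-- `t ↦ x^{−(1+it)}` (`x > 0`) is continuous. [folklore] -/
private theorem continuous_cpow_neg_line {x : ℝ} (hx : 0 < x) :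
    Continuous fun t : ℝ => (x : ℂ) ^ (-(1 + t * I)) :=
  (continuous_iff_continuousAt.mpr fun b =>
    continuousAt_const_cpow (ofReal_ne_zero.mpr hx.ne')).comp (by fun_prop)

/-- `t ↦ x^{1+it}` (`x > 0`) is continuous. [folklore] -/
private theorem continuous_cpow_line {x : ℝ} (hx : 0 < x) :
    Continuous fun t : ℝ => (x : ℂ) ^ (1 + (t : ℂ) * I) :=
  (continuous_iff_continuousAt.mpr fun b =>
    continuousAt_const_cpow (ofReal_ne_zero.mpr hx.ne')).comp (by fun_prop)

/-- `‖x^{−(1+it)}‖ = x⁻¹` and `‖x^{1+it}‖ = x` for `x > 0`. [folklore] -/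
private theorem norm_cpow_line {x : ℝ} (hx : 0 < x) (t : ℝ) :
    ‖(x : ℂ) ^ (-(1 + t * I))‖ = x⁻¹ ∧ ‖(x : ℂ) ^ (1 + (t : ℂ) * I)‖ = x :=
  ⟨by rw [Complex.norm_cpow_eq_rpow_re_of_pos hx]; simp [Real.rpow_neg_one],
   by rw [Complex.norm_cpow_eq_rpow_re_of_pos hx]; simp⟩

/-- The Mellin kernel at `x = c/p` splits: `(c/p)^{−s} = (c⁻¹)^{s}·p^{s}` (`s = 1+it`, `c > 0`).
[cite: Zhang2022LandauSiegel, §7 (7.14)] -/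
private theorem cpow_kernel_eq {c : ℝ} (hc : 0 < c) {p : ℕ} (hp : 0 < p) (t : ℝ) :
    (((c / p : ℝ)) : ℂ) ^ (-(1 + (t : ℂ) * I))
      = ((c⁻¹ : ℝ) : ℂ) ^ (1 + (t : ℂ) * I) * ((p : ℕ) : ℂ) ^ (1 + (t : ℂ) * I) := by
  set s : ℂ := 1 + (t : ℂ) * I with hs
  have hxpos : 0 < c / p := by positivity
  have harg : (((c / p : ℝ)) : ℂ).arg ≠ π := by
    rw [Complex.arg_ofReal_of_nonneg hxpos.le]; exact Real.pi_ne_zero.symm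
  rw [Complex.cpow_neg, ← Complex.inv_cpow _ s harg, ← Complex.ofReal_inv, inv_div,
    show (p : ℝ) / c = c⁻¹ * (p : ℝ) by rw [div_eq_mul_inv, mul_comm], Complex.ofReal_mul,
    Complex.mul_cpow_ofReal_nonneg (inv_nonneg.mpr hc.le) (Nat.cast_nonneg p)]
  norm_cast

/-- `((hr)/l)^{s} = (hr)^{s}·l^{−s}` for positive reals (`s = 1+it`). [folklore] -/
private theorem cpow_div_eq {a b : ℝ} (ha : 0 < a) (hb : 0 < b) (s : ℂ) :
    (((a / b : ℝ)) : ℂ) ^ s = (a : ℂ) ^ s * (b : ℂ) ^ (-s) := by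
  have hbarg : ((b : ℝ) : ℂ).arg ≠ π := by
    rw [Complex.arg_ofReal_of_nonneg hb.le]; exact Real.pi_ne_zero.symm
  rw [show (a / b : ℝ) = a * b⁻¹ from div_eq_mul_inv a b, Complex.ofReal_mul,
    Complex.mul_cpow_ofReal_nonneg ha.le (inv_nonneg.mpr hb.le), Complex.ofReal_inv,
    Complex.inv_cpow _ _ hbarg, Complex.cpow_neg]

variable (c' : ℝ)

/-- `t ↦ Σ_l (κ∗a₁)(dl)θ(l)l^{−(1+it)}` (the `l`-polynomial `lPoly` on `σ = 1`) is continuous, and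
bounded by `Σ_l ‖(κ∗a₁)(dl)‖`. [cite: Zhang2022LandauSiegel, §7 p.38] -/
theorem continuous_lPoly_line (D : ℕ) (a₁ : ℕ → ℂ) (R : ℝ) (r h d : ℕ)
    (θ : DirichletCharacter ℂ r) :
    Continuous (fun t : ℝ => lPoly c' D a₁ R r h d θ (1 + t * I)) ∧
      ∀ t : ℝ, ‖lPoly c' D a₁ R r h d θ (1 + t * I)‖ ≤
        ∑ l ∈ (natI D (R * h)).filter (fun l => Nat.Coprime l h),
          ‖MeanSquareMajorant.conv (kappaZ c' D) a₁ (d * l)‖ := by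
  have hlpos : ∀ l ∈ (natI D (R * h)).filter (fun l => Nat.Coprime l h), 0 < l := by
    intro l hl
    exact ((Finset.mem_filter.mp (Finset.mem_filter.mp hl).1).2).1
  constructor
  · unfold lPoly
    refine continuous_finsetSum _ fun l hl => ?_
    have hl0 : (0 : ℝ) < l := by exact_mod_cast hlpos l hl
    have := continuous_cpow_neg_line hl0
    simp only [Complex.ofReal_natCast] at this
    exact continuous_const.mul this
  · intro t
    unfold lPoly
    refine (norm_sum_le _ _).trans (Finset.sum_le_sum fun l hl => ?_)
    have hl0 : (0 : ℝ) < l := by exact_mod_cast hlpos l hl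
    have hn : ‖((l : ℕ) : ℂ) ^ (-(1 + (t : ℂ) * I))‖ = (l : ℝ)⁻¹ := by
      have := (norm_cpow_line hl0 t).1
      simpa using this
    rw [norm_mul, norm_mul, hn]
    have h1 : ‖θ (l : ZMod r)‖ ≤ 1 := θ.norm_le_one _
    have h2 : (l : ℝ)⁻¹ ≤ 1 := inv_le_one_of_one_le₀ (by exact_mod_cast hlpos l hl)
    calc ‖MeanSquareMajorant.conv (kappaZ c' D) a₁ (d * l)‖ * ‖θ (l : ZMod r)‖ * (l : ℝ)⁻¹
        ≤ ‖MeanSquareMajorant.conv (kappaZ c' D) a₁ (d * l)‖ * 1 * 1 := by gcongr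
      _ = _ := by ring

/-- `t ↦ Σ_{p∼P} θ̄(p)p^{1+it+β}` (the `p`-polynomial `pPoly` on `σ = 1`) is continuous and bounded by
`Σ_{p∼P} ‖p^β θ̄(p)‖·p`. [cite: Zhang2022LandauSiegel, §7 (7.14)] -/
theorem continuous_pPoly_line (D r : ℕ) (θ : DirichletCharacter ℂ r) (β : ℂ) :
    Continuous (fun t : ℝ => pPoly D r θ (1 + t * I + β)) ∧
      ∀ t : ℝ, ‖pPoly D r θ (1 + t * I + β)‖ ≤
        ∑ p ∈ primeWindow D, ‖(p : ℂ) ^ β * θ⁻¹ (p : ZMod r)‖ * p := by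
  have hrew : ∀ t : ℝ, pPoly D r θ (1 + t * I + β) =
      ∑ p ∈ primeWindow D, ((p : ℂ) ^ β * θ⁻¹ (p : ZMod r)) * (p : ℂ) ^ (1 + (t : ℂ) * I) :=
    fun t => (primeSum_twist_eq_pPoly D r θ β t).symm
  constructor
  · have h : Continuous fun t : ℝ =>
        ∑ p ∈ primeWindow D, ((p : ℂ) ^ β * θ⁻¹ (p : ZMod r)) * (p : ℂ) ^ (1 + (t : ℂ) * I) := by
      refine continuous_finsetSum _ fun p hp => ?_
      have hp0 : (0 : ℝ) < p := by exact_mod_cast (Finset.mem_filter.mp hp).2.pos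
      have := continuous_cpow_line hp0
      simp only [Complex.ofReal_natCast] at this
      exact continuous_const.mul this
    exact h.congr fun t => (hrew t).symm
  · intro t
    rw [hrew t]
    refine (norm_sum_le _ _).trans (Finset.sum_le_sum fun p hp => ?_)
    have hp : 0 < p := (Finset.mem_filter.mp hp).2.pos
    rw [norm_mul, Complex.norm_natCast_cpow_of_pos hp]
    simp

/-! ### §2. The exact Mellin identity for `𝔰*` -/

/-- **`Z22:§7.u038`, the exact form.** For all large `D`: for every `a₁`, `R`, `d`, every
`h, r ≥ 1` and every character `θ (mod r)`,
`𝔰*(R,r,h,d;θ) = (1/2π)∫ δ(1+it)·(hr)^{1+it}·lPoly(1+it)·pPoly(1+it+β₃) dt`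
— "By the Mellin transform": `Δ(l/(phr)) = (1/2π)∫(l/(phr))^{−(1+it)}δ(1+it)dt` (tree
`Skeleton.DeltaW_eq_mellinInv`) inserted into the finite double sum defining `𝔰*`.
[cite: Zhang2022LandauSiegel, §7 p.38] -/
theorem frakSstar_eq_integral :
    ForAllLarge fun D _ _ => ∀ (a₁ : ℕ → ℂ) (R : ℝ) (r h d : ℕ) (θ : DirichletCharacter ℂ r),
      0 < r → 0 < h →
        frakSstar c' D a₁ R r h d θ = ((1 / (2 * π) : ℝ) : ℂ) *
          ∫ t : ℝ, deltaW D (1 + t * I) * (((h * r : ℕ) : ℝ) : ℂ) ^ (1 + (t : ℂ) * I) *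
            lPoly c' D a₁ R r h d θ (1 + t * I) * pPoly D r θ (1 + t * I + beta3 c' D) := by
  obtain ⟨D₀, hall⟩ := DeltaW_eq_mellinInv.and integrable_deltaW_line
  refine ⟨D₀, fun D _ χ hD hq hp a₁ R r h d θ hr hh => ?_⟩
  obtain ⟨hinv, hint⟩ := hall D χ hD hq hp
  set S : Finset ℕ := (natI D (R * h)).filter (fun l => Nat.Coprime l h) with hS
  set β : ℂ := beta3 c' D with hβ
  have hlpos : ∀ l ∈ S, 0 < l := fun l hl =>
    ((Finset.mem_filter.mp (Finset.mem_filter.mp hl).1).2).1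
  have hhr : (0 : ℝ) < ((h * r : ℕ) : ℝ) := by exact_mod_cast Nat.mul_pos hh hr
  have inner : ∀ l ∈ S,
      ∑ p ∈ primeWindow D, θ⁻¹ (p : ZMod r) * (p : ℂ) ^ β * DeltaW D ((l : ℝ) / ((p : ℝ) * h * r))
        = ((1 / (2 * π) : ℝ) : ℂ) * ∫ t : ℝ, deltaW D (1 + t * I) *
            ((((h * r : ℕ) : ℝ) : ℂ) ^ (1 + (t : ℂ) * I) * ((l : ℕ) : ℂ) ^ (-(1 + (t : ℂ) * I))) *
              pPoly D r θ (1 + t * I + β) := by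
    intro l hl
    have hl0 : (0 : ℝ) < l := by exact_mod_cast hlpos l hl
    set c : ℝ := (l : ℝ) / ((h * r : ℕ) : ℝ) with hcdef
    have hc : 0 < c := by positivity
    have e1 : ∀ p : ℕ, (l : ℝ) / ((p : ℝ) * h * r) = c / p := by
      intro p; rw [hcdef]; push_cast; rw [div_div]; ring_nf
    have hFint : ∀ p ∈ primeWindow D, Integrable fun t : ℝ =>
        ((p : ℂ) ^ β * θ⁻¹ (p : ZMod r)) *
          ((((c / p : ℝ)) : ℂ) ^ (-(1 + t * I)) * deltaW D (1 + t * I)) := by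
      intro p hp'
      have hpp : 0 < p := (Finset.mem_filter.mp hp').2.pos
      have hx : 0 < c / p := by positivity
      exact (hint.bdd_mul (continuous_cpow_neg_line hx).aestronglyMeasurable
        (Eventually.of_forall fun t => (norm_cpow_line hx t).1.le)).const_mul _
    calc ∑ p ∈ primeWindow D, θ⁻¹ (p : ZMod r) * (p : ℂ) ^ β * DeltaW D ((l : ℝ) / ((p : ℝ) * h * r))
        = ∑ p ∈ primeWindow D, ((p : ℂ) ^ β * θ⁻¹ (p : ZMod r)) * DeltaW D (c / p) := by
          refine Finset.sum_congr rfl fun p _ => ?_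
          rw [e1]; ring
      _ = ((1 / (2 * π) : ℝ) : ℂ) * ∫ t : ℝ, ∑ p ∈ primeWindow D,
            ((p : ℂ) ^ β * θ⁻¹ (p : ZMod r)) *
              ((((c / p : ℝ)) : ℂ) ^ (-(1 + t * I)) * deltaW D (1 + t * I)) := by
          rw [integral_finsetSum _ hFint, Finset.mul_sum]
          refine Finset.sum_congr rfl fun p hp' => ?_
          have hpp : 0 < p := (Finset.mem_filter.mp hp').2.pos
          have hx : 0 < c / p := by positivity
          rw [hinv _ hx, integral_const_mul, Complex.real_smul]
          simp_rw [smul_eq_mul]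
          ring
      _ = ((1 / (2 * π) : ℝ) : ℂ) * ∫ t : ℝ, deltaW D (1 + t * I) *
            ((((h * r : ℕ) : ℝ) : ℂ) ^ (1 + (t : ℂ) * I) * ((l : ℕ) : ℂ) ^ (-(1 + (t : ℂ) * I))) *
              pPoly D r θ (1 + t * I + β) := by
          congr 1
          refine integral_congr_ae (Eventually.of_forall fun t => ?_)
          have e2 : ∑ p ∈ primeWindow D, ((p : ℂ) ^ β * θ⁻¹ (p : ZMod r)) *
              ((((c / p : ℝ)) : ℂ) ^ (-(1 + t * I)) * deltaW D (1 + t * I))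
              = (∑ p ∈ primeWindow D, ((p : ℂ) ^ β * θ⁻¹ (p : ZMod r)) *
                  (((c / p : ℝ)) : ℂ) ^ (-(1 + t * I))) * deltaW D (1 + t * I) := by
            rw [Finset.sum_mul]; exact Finset.sum_congr rfl fun p _ => by ring
          have e3 : ∑ p ∈ primeWindow D, ((p : ℂ) ^ β * θ⁻¹ (p : ZMod r)) *
              (((c / p : ℝ)) : ℂ) ^ (-(1 + t * I))
              = ((c⁻¹ : ℝ) : ℂ) ^ (1 + (t : ℂ) * I) * pPoly D r θ (1 + t * I + β) := by
            rw [← primeSum_twist_eq_pPoly, Finset.mul_sum]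
            refine Finset.sum_congr rfl fun p hp' => ?_
            have hpp : 0 < p := (Finset.mem_filter.mp hp').2.pos
            rw [cpow_kernel_eq hc hpp t]; ring
          have e4 : ((c⁻¹ : ℝ) : ℂ) ^ (1 + (t : ℂ) * I) =
              (((h * r : ℕ) : ℝ) : ℂ) ^ (1 + (t : ℂ) * I) * ((l : ℕ) : ℂ) ^ (-(1 + (t : ℂ) * I)) := by
            rw [hcdef, inv_div, cpow_div_eq hhr hl0]
            norm_cast
          simp only [e2, e3, e4]
          ring
  have hLint : ∀ l ∈ S, Integrable fun t : ℝ =>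
      (MeanSquareMajorant.conv (kappaZ c' D) a₁ (d * l) * θ (l : ZMod r)) *
        (deltaW D (1 + t * I) *
          ((((h * r : ℕ) : ℝ) : ℂ) ^ (1 + (t : ℂ) * I) * ((l : ℕ) : ℂ) ^ (-(1 + (t : ℂ) * I))) *
          pPoly D r θ (1 + t * I + β)) := by
    intro l hl
    have hl0 : (0 : ℝ) < l := by exact_mod_cast hlpos l hl
    obtain ⟨hpc, hpb⟩ := continuous_pPoly_line D r θ β
    have hc1 : Continuous fun t : ℝ =>
        ((((h * r : ℕ) : ℝ) : ℂ) ^ (1 + (t : ℂ) * I) * ((l : ℕ) : ℂ) ^ (-(1 + (t : ℂ) * I))) *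
          pPoly D r θ (1 + t * I + β) := by
      have h1 := continuous_cpow_line hhr
      have h2 := continuous_cpow_neg_line hl0
      simp only [Complex.ofReal_natCast] at h2
      exact (h1.mul h2).mul hpc
    have hbd : ∀ t : ℝ, ‖((((h * r : ℕ) : ℝ) : ℂ) ^ (1 + (t : ℂ) * I) *
        ((l : ℕ) : ℂ) ^ (-(1 + (t : ℂ) * I))) * pPoly D r θ (1 + t * I + β)‖ ≤
        ((h * r : ℕ) : ℝ) * (l : ℝ)⁻¹ *
          ∑ p ∈ primeWindow D, ‖(p : ℂ) ^ β * θ⁻¹ (p : ZMod r)‖ * p := by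
      intro t
      have n1 := (norm_cpow_line hhr t).2
      have n2 : ‖((l : ℕ) : ℂ) ^ (-(1 + (t : ℂ) * I))‖ = (l : ℝ)⁻¹ := by
        have := (norm_cpow_line hl0 t).1; simpa using this
      rw [norm_mul, norm_mul, n1, n2]
      gcongr
      exact hpb t
    have := hint.mul_bdd hc1.aestronglyMeasurable (Eventually.of_forall hbd)
    exact (this.congr (Eventually.of_forall fun t => by ring)).const_mul _
  unfold frakSstar
  rw [show (natI D (R * h)).filter (fun l => Nat.Coprime l h) = S from rfl]
  calc ∑ l ∈ S, MeanSquareMajorant.conv (kappaZ c' D) a₁ (d * l) * θ (l : ZMod r) *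
          ∑ p ∈ primeWindow D, θ⁻¹ (p : ZMod r) * (p : ℂ) ^ beta3 c' D *
            DeltaW D ((l : ℝ) / ((p : ℝ) * h * r))
      = ∑ l ∈ S, ((1 / (2 * π) : ℝ) : ℂ) * ∫ t : ℝ,
          (MeanSquareMajorant.conv (kappaZ c' D) a₁ (d * l) * θ (l : ZMod r)) *
            (deltaW D (1 + t * I) *
              ((((h * r : ℕ) : ℝ) : ℂ) ^ (1 + (t : ℂ) * I) * ((l : ℕ) : ℂ) ^ (-(1 + (t : ℂ) * I))) *
              pPoly D r θ (1 + t * I + β)) := by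
        refine Finset.sum_congr rfl fun l hl => ?_
        rw [inner l hl, integral_const_mul]
        ring
    _ = ((1 / (2 * π) : ℝ) : ℂ) * ∫ t : ℝ, ∑ l ∈ S,
          (MeanSquareMajorant.conv (kappaZ c' D) a₁ (d * l) * θ (l : ZMod r)) *
            (deltaW D (1 + t * I) *
              ((((h * r : ℕ) : ℝ) : ℂ) ^ (1 + (t : ℂ) * I) * ((l : ℕ) : ℂ) ^ (-(1 + (t : ℂ) * I))) *
              pPoly D r θ (1 + t * I + β)) := by
        rw [integral_finsetSum _ hLint, Finset.mul_sum]
    _ = _ := by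
        congr 1
        refine integral_congr_ae (Eventually.of_forall fun t => ?_)
        simp only [lPoly, hS, Finset.sum_mul, Finset.mul_sum]
        refine Finset.sum_congr rfl fun l _ => ?_
        ring

/-! ### §3. The bound with the exact weight, and the node with the factor `hr` restored -/

/-- **`|𝔰*| ≤ hr·(1/2π)·∫|δ(1+it)|·|lPoly(1+it)|·|pPoly(1+it+β₃)| dt`** for all large `D` (every `a₁`,
`R`, `d`, `h, r ≥ 1`, `θ mod r`), with the integrand integrable — the Mellin step for `𝔰*` BEFORE
Lemma 5.4 (i) replaces `|δ(1+it)|` by `𝓛^c/(1+t²)`; note the factor `hr = |(hr)^{1+it}|`.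
[cite: Zhang2022LandauSiegel, §7 p.38] -/
theorem norm_frakSstar_le :
    ForAllLarge fun D _ _ => ∀ (a₁ : ℕ → ℂ) (R : ℝ) (r h d : ℕ) (θ : DirichletCharacter ℂ r),
      0 < r → 0 < h →
        Integrable (fun t : ℝ => ‖deltaW D (1 + t * I)‖ *
            (‖lPoly c' D a₁ R r h d θ (1 + t * I)‖ * ‖pPoly D r θ (1 + t * I + beta3 c' D)‖)) ∧
        ‖frakSstar c' D a₁ R r h d θ‖ ≤ ((h * r : ℕ) : ℝ) * (1 / (2 * π)) *
          ∫ t : ℝ, ‖deltaW D (1 + t * I)‖ *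
            (‖lPoly c' D a₁ R r h d θ (1 + t * I)‖ * ‖pPoly D r θ (1 + t * I + beta3 c' D)‖) := by
  obtain ⟨D₀, hall⟩ := (frakSstar_eq_integral c').and integrable_deltaW_line
  refine ⟨D₀, fun D _ χ hD hq hp a₁ R r h d θ hr hh => ?_⟩
  obtain ⟨heq, hint⟩ := hall D χ hD hq hp
  have hhr : (0 : ℝ) < ((h * r : ℕ) : ℝ) := by exact_mod_cast Nat.mul_pos hh hr
  obtain ⟨hlc, hlb⟩ := continuous_lPoly_line c' D a₁ R r h d θ
  obtain ⟨hpc, hpb⟩ := continuous_pPoly_line D r θ (beta3 c' D)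
  set Bl : ℝ := ∑ l ∈ (natI D (R * h)).filter (fun l => Nat.Coprime l h),
    ‖MeanSquareMajorant.conv (kappaZ c' D) a₁ (d * l)‖ with hBl
  set Bp : ℝ := ∑ p ∈ primeWindow D, ‖(p : ℂ) ^ beta3 c' D * θ⁻¹ (p : ZMod r)‖ * p with hBp
  have hBl0 : 0 ≤ Bl := by rw [hBl]; positivity
  have hbound : ∀ t : ℝ,
      ‖‖lPoly c' D a₁ R r h d θ (1 + t * I)‖ * ‖pPoly D r θ (1 + t * I + beta3 c' D)‖‖ ≤ Bl * Bp := by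
    intro t
    rw [Real.norm_of_nonneg (by positivity)]
    exact mul_le_mul (hlb t) (hpb t) (norm_nonneg _) hBl0
  have hI : Integrable (fun t : ℝ => ‖deltaW D (1 + t * I)‖ *
      (‖lPoly c' D a₁ R r h d θ (1 + t * I)‖ * ‖pPoly D r θ (1 + t * I + beta3 c' D)‖)) :=
    hint.norm.mul_bdd (hlc.norm.mul hpc.norm).aestronglyMeasurable (Eventually.of_forall hbound)
  refine ⟨hI, ?_⟩
  rw [heq a₁ R r h d θ hr hh, norm_mul, Complex.norm_real,
    Real.norm_of_nonneg (by positivity : (0 : ℝ) ≤ 1 / (2 * π))]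
  have hpt : ∀ t : ℝ, ‖deltaW D (1 + t * I) * (((h * r : ℕ) : ℝ) : ℂ) ^ (1 + (t : ℂ) * I) *
      lPoly c' D a₁ R r h d θ (1 + t * I) * pPoly D r θ (1 + t * I + beta3 c' D)‖ =
      ((h * r : ℕ) : ℝ) * (‖deltaW D (1 + t * I)‖ *
        (‖lPoly c' D a₁ R r h d θ (1 + t * I)‖ * ‖pPoly D r θ (1 + t * I + beta3 c' D)‖)) := by
    intro t
    rw [norm_mul, norm_mul, norm_mul, (norm_cpow_line hhr t).2]
    ring
  calc 1 / (2 * π) * ‖∫ t : ℝ, deltaW D (1 + t * I) * (((h * r : ℕ) : ℝ) : ℂ) ^ (1 + (t : ℂ) * I) *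
          lPoly c' D a₁ R r h d θ (1 + t * I) * pPoly D r θ (1 + t * I + beta3 c' D)‖
      ≤ 1 / (2 * π) * ∫ t : ℝ, ‖deltaW D (1 + t * I) * (((h * r : ℕ) : ℝ) : ℂ) ^ (1 + (t : ℂ) * I) *
          lPoly c' D a₁ R r h d θ (1 + t * I) * pPoly D r θ (1 + t * I + beta3 c' D)‖ :=
        mul_le_mul_of_nonneg_left (norm_integral_le_integral_norm _) (by positivity)
    _ = ((h * r : ℕ) : ℝ) * (1 / (2 * π)) * ∫ t : ℝ, ‖deltaW D (1 + t * I)‖ *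
          (‖lPoly c' D a₁ R r h d θ (1 + t * I)‖ * ‖pPoly D r θ (1 + t * I + beta3 c' D)‖) := by
        simp_rw [hpt]
        rw [integral_const_mul]
        ring

/-- **`Z22:§7.u038` with the factor `hr` restored (the derivable form).** In the binders of the typed
node `Section7cStatements.Step7u038 c′` but with right side multiplied by `hr`:
for every `B` there are `k = 5190` and `C` such that for all large `D` (under (A), unused) and every
admissible `𝐚₁`, every `d, h ≥ 1`, `R` in the range (7.15), every `R ≤ r < 2R` and every `θ (mod r)`,
`|𝔰*(R,r,h,d;θ)| ≤ C𝓛ᵏ·hr·∫|Σ_l(κ∗a₁)(dl)θ(l)l^{−1−it}|·|Σ_pθ̄(p)p^{1+it+β₃}|dt/(1+t²)`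
(Lemma 5.4 (i) on `σ = 1`: tree `Skeleton.norm_deltaW_line_le`). The display AS PRINTED omits `hr`
and is not derivable (GAP-LEDGER G-d26-1); the printed conclusion of the chain (tex L2055) uses exactly
this `hr ≤ 2hR` form. [cite: Zhang2022LandauSiegel, §7 p.38] -/
theorem step7u038R_holds :
    ∀ B : ℝ, ∃ k : ℕ, ∃ C : ℝ, ForAllLarge fun D _ χ => AssumptionA D χ →
      ∀ a₁ : ℕ → ℂ, Adm72 D B a₁ → ∀ (d h : ℕ) (R : ℝ), 0 < d → 0 < h →
        InRange735 D d h R → ∀ r ∈ dyadic R, ∀ θ : DirichletCharacter ℂ r,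
          ‖frakSstar c' D a₁ R r h d θ‖ ≤
            C * ell D ^ k * ((h * r : ℕ) : ℝ) *
              ∫ t : ℝ, ‖lPoly c' D a₁ R r h d θ (1 + t * I)‖ *
                ‖pPoly D r θ (1 + t * I + beta3 c' D)‖ / (1 + t ^ 2) := by
  intro B
  set K : ℝ := (2 * Lemma53.Jconst 1 2 + 4 * ((2 + Real.exp 1) * (4 * π) ^ 2
      * Real.exp (((5 : ℕ) : ℝ) ^ 2) + (Real.exp 1 * ((2 * 5).factorial : ℝ) + 5 ^ 5)
      * Lemma53.Jconst 1 2)) with hK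
  have hJ0 : 0 ≤ Lemma53.Jconst 1 2 := Lemma53.Jconst_nonneg' 1 2
  have hK0 : 0 ≤ K := by positivity
  obtain ⟨D₀, hall⟩ := norm_frakSstar_le c'
  refine ⟨5190, K * (1 / (2 * π)), max D₀ 3, fun D _ χ hD hq hp _ a₁ _ d h R _ hh hR r hr θ => ?_⟩
  have hD3 : 3 ≤ D := le_trans (le_max_right _ _) hD
  have hrpos : 0 < r := by
    have h1 : (D : ℝ) ≤ R := hR.2.1
    have h2 : R ≤ (r : ℝ) := ((Finset.mem_filter.mp hr).2).1
    have h3 : (3 : ℝ) ≤ D := by exact_mod_cast hD3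
    exact_mod_cast (show (0 : ℝ) < r by linarith)
  obtain ⟨hI, hle⟩ := hall D χ (le_trans (le_max_left _ _) hD) hq hp a₁ R r h d θ hrpos hh
  obtain ⟨hlc, hlb⟩ := continuous_lPoly_line c' D a₁ R r h d θ
  obtain ⟨hpc, hpb⟩ := continuous_pPoly_line D r θ (beta3 c' D)
  set F : ℝ → ℝ := fun t =>
    ‖lPoly c' D a₁ R r h d θ (1 + t * I)‖ * ‖pPoly D r θ (1 + t * I + beta3 c' D)‖ with hF
  have hBl0 : 0 ≤ ∑ l ∈ (natI D (R * h)).filter (fun l => Nat.Coprime l h),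
      ‖MeanSquareMajorant.conv (kappaZ c' D) a₁ (d * l)‖ := by positivity
  have hbdd : Integrable fun t : ℝ => (1 + t ^ 2)⁻¹ * F t :=
    integrable_inv_one_add_sq.mul_bdd (hlc.norm.mul hpc.norm).aestronglyMeasurable
      (Eventually.of_forall fun t => by
        rw [Real.norm_of_nonneg (by positivity)]
        exact mul_le_mul (hlb t) (hpb t) (norm_nonneg _) hBl0)
  have hmaj : Integrable fun t : ℝ => K * ell D ^ 5190 * ((1 + t ^ 2)⁻¹ * F t) := hbdd.const_mul _
  have hcmp : ∫ t : ℝ, ‖deltaW D (1 + t * I)‖ * F t ≤ K * ell D ^ 5190 * ∫ t : ℝ, F t / (1 + t ^ 2) := by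
    calc ∫ t : ℝ, ‖deltaW D (1 + t * I)‖ * F t
        ≤ ∫ t : ℝ, K * ell D ^ 5190 * ((1 + t ^ 2)⁻¹ * F t) := by
          refine integral_mono hI hmaj fun t => ?_
          have h1 := norm_deltaW_line_le hD3 t
          have hF0 : 0 ≤ F t := by rw [hF]; positivity
          calc ‖deltaW D (1 + t * I)‖ * F t ≤ K * ell D ^ 5190 * (1 + t ^ 2)⁻¹ * F t :=
                mul_le_mul_of_nonneg_right h1 hF0
            _ = _ := by ring
      _ = K * ell D ^ 5190 * ∫ t : ℝ, F t / (1 + t ^ 2) := by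
          rw [integral_const_mul]
          congr 1
          exact integral_congr_ae (Eventually.of_forall fun t => by
            simp only [div_eq_mul_inv, mul_comm])
  have hhr0 : (0 : ℝ) ≤ ((h * r : ℕ) : ℝ) := Nat.cast_nonneg _
  calc ‖frakSstar c' D a₁ R r h d θ‖
      ≤ ((h * r : ℕ) : ℝ) * (1 / (2 * π)) * ∫ t : ℝ, ‖deltaW D (1 + t * I)‖ * F t := hle
    _ ≤ ((h * r : ℕ) : ℝ) * (1 / (2 * π)) * (K * ell D ^ 5190 * ∫ t : ℝ, F t / (1 + t ^ 2)) :=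
        mul_le_mul_of_nonneg_left hcmp (by positivity)
    _ = K * (1 / (2 * π)) * ell D ^ (5190 : ℕ) * ((h * r : ℕ) : ℝ) *
          ∫ t : ℝ, F t / (1 + t ^ 2) := by ring

end Literature.NumberTheory.LFunctions.Zhang2022.Section7cMellin
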